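import Summits.QuantumFields.BalabanUV.T4Continuum.Support.NE7K1LinTorusLineInvariant

/-!
# NE7K1LinTorusLineSymbol — row NE7 (node U5), candidate route HOM, path H1L, cell K1-lin(s): THE SYMBOL `σ_s(p)` OF THE DOUBLED-TORUS
# TWO-CUTOFF LINE EXISTS IN KERNEL — plane waves of `Π_μ ℤ∕2N_μ` are eigenvectors of `T^𝕋(s)` at `a = 0`, with eigenvalue the finite
# Fourier sum of its convolution row (NEEDS-ESTIMATE #E1, B-E1's carrier `σ_s = (1−s)NN + s·k̃_L` as a kernel object)

Lineage `b2b-balaban-t4-ne7-p2` (CRUX PROVER NE7 #2), generation 72; file 37.  File 36 (`NE7K1LinTorusLineInvariant`) proved that at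
`a = 0` the doubled-torus line `T^𝕋(s)` is translation-invariant.  THIS FILE draws the [folklore] consequence B-E1 talks about:

* §1 THE CHARACTERS `chiT P p y = exp(2πi·Σ_μ p_μy_μ∕P_μ)` of `Π_μ ℤ∕P_μ` on lattice points: multiplicative (`chiT_add`), `P`-periodic
  (`chiT_period`), hence functions of the representative (`chiT_wrap`).
* §2 ABSTRACT DIAGONALISATION: for a real matrix `X` on the representatives `boxDom P` with `X(x+v, y+v) = X(x, y)` (all `v`), every
  plane wave is an eigenvector: **`sum_mul_chiT_of_transl`** `Σ_y X(x,y)·χ_p(y) = symbT X y₀ p · χ_p(x)` with the SYMBOL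
  `symbT X y₀ p = Σ_y X(y₀, y)·χ_p(y − y₀)` (any base point `y₀`; the shift `y ↦ y − v` is a bijection of the representatives,
  `shiftEquiv`).
* §3 **`torLine_zero_planeWave`**: at `a = 0`, for every `s`, every mesh `n`, `L`, box `M` and every dual index `p`,
  `Σ_y T^𝕋(s)(x, y)·χ_p(y) = σ_s(p)·χ_p(x)` with **`torSymb … s y₀ p`** `= Σ_y T^𝕋(s)(y₀, y)χ_p(y − y₀)` — lens 2's
  `σ_s = (1−s)NN + s·k̃_L` (at mesh `n`: `σ_s^{(n)}`) as a DEFINED kernel object with its eigen-relation; by files 34–35 its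
  Löwner facts descend to the Neumann box.

HONEST FRAMING: [folklore] (finite Fourier analysis on a discrete torus); no estimate; the class-S CLAUSES of B-E1 (window, strip,
floors) are NOT typed here — only their object; `a = 0`; nothing of Bałaban's asserted; no `sorry`.  Census only; NE7 NOT PRINTED ∕ NOT
PROVED; spine 0∕9; FIXED FINITE T⁴, rung (B)+1; NOT infinite volume, NOT mass gap, NOT Clay.  HONEST DEPENDENCY: continuum YM on T⁴
⇐ BetaPertH ∧ nine spine estimates (0/9 proved); BetaPertH ⇐ (D1) ∧ (D4) ∧ CAP+tail; G-an2-4 gates asym, D1 and NE2/3/4.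
-/

noncomputable section

open Finset Matrix Complex

namespace Summit.QuantumFields.BalabanUV.T4Continuum.NE7K1LinTorusLineSymbol

open Literature.MathematicalPhysics.QuantumFieldTheory.Balaban1983to89
open Literature.MathematicalPhysics.QuantumFieldTheory.Balaban1983to89.B4Reflection242
open Literature.MathematicalPhysics.QuantumFieldTheory.Balaban1983to89.B4Lower18
open Literature.MathematicalPhysics.QuantumFieldTheory.Balaban1983to89.B4TorusPositivity (wrap wrap_wrap_add)
open NE7K1LinFoldKernels NE7K1LinFoldMatrices NE7K1LinSchurFoldBox NE7K1LinTorusLineInvariant NE7K1LinSchurLineU1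

variable {d : ℕ}

/-! ### §1 Characters of the discrete torus on lattice points -/

/-- the CHARACTER `χ_p(y) = exp(2πi·Σ_μ p_μ y_μ ∕ P_μ)` of `Π_μ ℤ∕P_μ`, on lattice points. [folklore] -/
def chiT (P : Fin (d + 1) → ℕ) (p y : Fin (d + 1) → ℤ) : ℂ :=
  Complex.exp ((∑ μ, ((p μ * y μ : ℤ) : ℂ) / (P μ : ℂ)) * (2 * Real.pi * Complex.I))

/-- characters are multiplicative: `χ_p(y + z) = χ_p(y)·χ_p(z)`. [folklore] -/
theorem chiT_add (P : Fin (d + 1) → ℕ) (p y z : Fin (d + 1) → ℤ) : chiT P p (y + z) = chiT P p y * chiT P p z := by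
  unfold chiT
  rw [← Complex.exp_add, ← add_mul, ← Finset.sum_add_distrib]
  congr 2
  refine Finset.sum_congr rfl fun μ _ => ?_
  simp only [Pi.add_apply]
  push_cast
  ring

/-- characters are `P`-periodic: `χ_p(y + P·m) = χ_p(y)`. [folklore] -/
theorem chiT_period {P : Fin (d + 1) → ℕ} (hP : ∀ i, 1 ≤ P i) (p y m : Fin (d + 1) → ℤ) :
    chiT P p (y + fun μ => (P μ : ℤ) * m μ) = chiT P p y := by
  rw [chiT_add]
  have h : chiT P p (fun μ => (P μ : ℤ) * m μ) = 1 := by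
    unfold chiT
    have e : ∑ μ, ((p μ * ((P μ : ℤ) * m μ) : ℤ) : ℂ) / (P μ : ℂ) = ((∑ μ, p μ * m μ : ℤ) : ℂ) := by
      push_cast
      refine Finset.sum_congr rfl fun μ _ => ?_
      have hP0 : (P μ : ℂ) ≠ 0 := by exact_mod_cast (show P μ ≠ 0 by have := hP μ; omega)
      field_simp
    rw [e]
    exact Complex.exp_int_mul_two_pi_mul_I _
  rw [h, mul_one]

/-- characters are functions of the representative: `χ_p(y mod P) = χ_p(y)`. [folklore] -/
theorem chiT_wrap {P : Fin (d + 1) → ℕ} (hP : ∀ i, 1 ≤ P i) (p y : Fin (d + 1) → ℤ) : chiT P p (wrap P y) = chiT P p y := by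
  have e : wrap P y = y + fun μ => (P μ : ℤ) * (-(y μ / (P μ : ℤ))) := by
    funext μ
    show y μ % (P μ : ℤ) = y μ + (P μ : ℤ) * (-(y μ / (P μ : ℤ)))
    linarith [Int.mul_ediv_add_emod (y μ) (P μ : ℤ)]
  rw [e, chiT_period hP]

/-! ### §2 Translation-invariant matrices on representatives are diagonal in plane waves -/

section Abstract

variable {P : Fin (d + 1) → ℕ}

/-- the shift `y ↦ y − v (mod P)` as a bijection of the representatives. [folklore] -/
def shiftEquiv (hP : ∀ i, 1 ≤ P i) (v : Fin (d + 1) → ℤ) : ↥(boxDom P) ≃ ↥(boxDom P) where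
  toFun y := ⟨wrap P (y.1 - v), wrap_mem_boxDom hP _⟩
  invFun z := ⟨wrap P (z.1 + v), wrap_mem_boxDom hP _⟩
  left_inv y := Subtype.ext (by
    show wrap P (wrap P (y.1 - v) + v) = y.1
    rw [wrap_wrap_add, sub_add_cancel, wrap_eq_self y.2])
  right_inv z := Subtype.ext (by
    show wrap P (wrap P (z.1 + v) - v) = z.1
    rw [sub_eq_add_neg, wrap_wrap_add, add_neg_cancel_right, wrap_eq_self z.2])

/-- the SYMBOL of a matrix on representatives at base point `y₀`: `Σ_y X(y₀, y)·χ_p(y − y₀)`. [folklore] -/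
def symbT (P : Fin (d + 1) → ℕ) (X : Matrix ↥(boxDom P) ↥(boxDom P) ℝ) (y₀ : ↥(boxDom P)) (p : Fin (d + 1) → ℤ) : ℂ :=
  ∑ y : ↥(boxDom P), (X y₀ y : ℂ) * chiT P p (y.1 - y₀.1)

/-- **PLANE WAVES DIAGONALISE TRANSLATION-INVARIANT MATRICES**: if `X(x+v, y+v) = X(x, y)` for all translations `v` of the
representatives then `Σ_y X(x,y)·χ_p(y) = symbT X y₀ p · χ_p(x)` for every `x` and every base point `y₀`. [folklore] -/
theorem sum_mul_chiT_of_transl (hP : ∀ i, 1 ≤ P i) (X : Matrix ↥(boxDom P) ↥(boxDom P) ℝ)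
    (hX : ∀ (v : Fin (d + 1) → ℤ) (x y : ↥(boxDom P)),
      X ⟨wrap P (x.1 + v), wrap_mem_boxDom hP _⟩ ⟨wrap P (y.1 + v), wrap_mem_boxDom hP _⟩ = X x y)
    (y₀ x : ↥(boxDom P)) (p : Fin (d + 1) → ℤ) :
    ∑ y : ↥(boxDom P), (X x y : ℂ) * chiT P p y.1 = symbT P X y₀ p * chiT P p x.1 := by
  classical
  -- translate by `v = y₀ − x`: `X(x, y) = X(y₀, y + v)`
  set v : Fin (d + 1) → ℤ := y₀.1 - x.1 with hv
  have hrow : ∀ y : ↥(boxDom P), X x y = X y₀ ⟨wrap P (y.1 + v), wrap_mem_boxDom hP _⟩ := by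
    intro y
    rw [← hX v x y]
    congr 1
    apply Subtype.ext
    show wrap P (x.1 + v) = y₀.1
    rw [hv, add_sub_cancel, wrap_eq_self y₀.2]
  simp_rw [hrow]
  -- re-index `z = y + v`
  rw [symbT, Finset.sum_mul]
  refine Fintype.sum_equiv (shiftEquiv hP (-v)) _ _ fun y => ?_
  simp only [shiftEquiv, Equiv.coe_fn_mk, sub_neg_eq_add]
  rw [mul_assoc, ← chiT_add]
  congr 1
  have e2 : wrap P (y.1 + v) - y₀.1 + x.1 = y.1 + fun μ => (P μ : ℤ) * (-((y.1 + v) μ / (P μ : ℤ))) := by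
    funext μ
    simp only [Pi.add_apply, Pi.sub_apply, wrap, hv]
    linarith [Int.mul_ediv_add_emod (y.1 μ + (y₀.1 μ - x.1 μ)) (P μ : ℤ)]
  rw [e2, chiT_period hP]

end Abstract

/-! ### §3 The symbol of the doubled-torus two-cutoff line at `a = 0` -/

section Line

variable {n L : ℕ} [NeZero L] {M : Fin (d + 1) → ℕ}

/-- the torus line as a matrix on the representatives `boxDom (dbl (n·M))` (transport along `image_fineTor`). [folklore] -/
def torLineRep (hn : 1 ≤ n) (M : Fin (d + 1) → ℕ) (s : ℝ) :
    Matrix ↥(boxDom (dbl fun i => n * M i)) ↥(boxDom (dbl fun i => n * M i)) ℝ :=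
  fun x y => torLine (isBlockUnion_fine (fineTor_isBlockUnion hn (NeZero.one_le : 1 ≤ L) M)) n 0 (fun i => n * L * M i)
    (fun i => n * M i) s ⟨x.1, by rw [image_fineTor (NeZero.one_le : 1 ≤ L) n M]; exact x.2⟩
    ⟨y.1, by rw [image_fineTor (NeZero.one_le : 1 ≤ L) n M]; exact y.2⟩

/-- the transported torus line is translation-invariant (file 36's `torLine_zero_transl_apply`). [folklore] -/
theorem torLineRep_transl (hn : 1 ≤ n) (hM : ∀ i, 1 ≤ M i) (s : ℝ) (v : Fin (d + 1) → ℤ)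
    (x y : ↥(boxDom (dbl fun i => n * M i))) :
    torLineRep (L := L) hn M s ⟨wrap (dbl fun i => n * M i) (x.1 + v), wrap_mem_boxDom (dbl_pos (mul_pos_side hn hM)) _⟩
        ⟨wrap (dbl fun i => n * M i) (y.1 + v), wrap_mem_boxDom (dbl_pos (mul_pos_side hn hM)) _⟩ =
      torLineRep (L := L) hn M s x y := by
  unfold torLineRep
  exact torLine_zero_transl_apply hn hM v s ⟨x.1, _⟩ ⟨y.1, _⟩

/-- **THE SYMBOL `σ_s(p)` OF THE DOUBLED-TORUS LINE** at base point `y₀`: `Σ_y T^𝕋(s)(y₀, y)·χ_p(y − y₀)` (lens 2's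
`σ_s = (1−s)NN + s·k̃_L` at mesh `n`, as a kernel object). [folklore] -/
def torSymb (hn : 1 ≤ n) (M : Fin (d + 1) → ℕ) (s : ℝ) (y₀ : ↥(boxDom (dbl fun i => n * M i))) (p : Fin (d + 1) → ℤ) : ℂ :=
  symbT (dbl fun i => n * M i) (torLineRep (L := L) hn M s) y₀ p

/-- **PLANE WAVES ARE EIGENVECTORS OF THE TORUS LINE at `a = 0`**: `Σ_y T^𝕋(s)(x, y)·χ_p(y) = σ_s(p)·χ_p(x)` for every `s`,
every representative `x`, every dual index `p` (and any base point `y₀` in `σ_s`). [folklore] -/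
theorem torLine_zero_planeWave (hn : 1 ≤ n) (hM : ∀ i, 1 ≤ M i) (s : ℝ) (y₀ x : ↥(boxDom (dbl fun i => n * M i)))
    (p : Fin (d + 1) → ℤ) :
    ∑ y : ↥(boxDom (dbl fun i => n * M i)), (torLineRep (L := L) hn M s x y : ℂ) * chiT (dbl fun i => n * M i) p y.1 =
      torSymb (L := L) hn M s y₀ p * chiT (dbl fun i => n * M i) p x.1 :=
  sum_mul_chiT_of_transl (dbl_pos (mul_pos_side hn hM)) _ (fun v x' y' => torLineRep_transl hn hM s v x' y') y₀ x p

end Line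

end Summit.QuantumFields.BalabanUV.T4Continuum.NE7K1LinTorusLineSymbol

end
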